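import Summits.CriticalPhenomena.PercolationContinuityZ3.Theorems.PercNearOneGluingNoHeavyLowerTailSunflowerTypeModelLemma
import Literature.Probability.Percolation.FoldingFibres
import HarnessLib

/-!
# `NoHeavyLowerTail` (crux stmt-CriticalPhenomena-4575), abstract sunflower cubic: BIPARTITE GRAPH CORES ARE A-SAFE — part 1: POLARISATION

Support file (seat `prim-ineq-prove-1` gen 40; `--supports stmt-CriticalPhenomena-4575`).  No `sorry`, no named facts.  Memo:
run/shared/lean/prim/prim-ineq-prove-1/FINDING-BIPARTITE-prove1-g40.md (§1 polarisation, §2 symmetrisation, §3 conditioning, §4 the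
type-model lemma = `TypeModel.Model.typeModel_lemma` of `…SunflowerTypeModelLemma`).

THE THEOREM (file `…SunflowerBipartiteSafe`, `Bridge.safe_edgeCore_of_bipartite`): **every bipartite graph core is safe for every
parameter vector** — if `L` is one side of a bipartition of `Γ : SimpleGraph (Fin n)` then `SafeCalc.Safe p (SafeCalc.edgeCore Γ)` for all
`p`, i.e. Lemma A `∏_k μ_p(V k) ≤ μ_p(A)^(K−1)` for every number `K` of petals (g39's conjecture `TriangleFreeSafe` on the bipartite
stratum: all trees, even cycles, grids, cubes, `K_{a,b}` minus anything, …).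

THIS FILE (§1 of the memo).  Transposed configurations `S : Fin n → Finset (Fin K)` (the slot set of every vertex), `row S k`, the
profile weight `wprof p S = ∏_x p_x^{|S x|} (1−p_x)^{K−|S x|}`, the transpose bijection with K-tuples of configurations, and
* `prod_real_eq_sum_wprof` : `∏_k (prodBernoulli p).real (V k) = Σ_S wprof p S · 𝟙[∀ k, row S k ∈ V k]` (via
  `prodBernoulli_real_eq_sum_weight_ind`, `Finset.prod_univ_sum` and the transpose);
* `sum_wprof_le_of_fibrewise` : a count inequality on every profile fibre `TypeModel.Model.confs m` gives the weighted inequality for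
  every `p`.
-/

namespace Summit.CriticalPhenomena.PercolationContinuityZ3.Theorems.SunflowerPartition

namespace Bridge

open Finset MeasureTheory Literature.Probability.LatticeModels Literature.Probability.Percolation

variable {K n : ℕ}

/-- Row `k` of a transposed configuration `S : Fin n → Finset (Fin K)` (slot sets of the vertices): the set of vertices whose slot
set contains `k`. -/
def row (S : Fin n → Finset (Fin K)) (k : Fin K) : Set (Fin n) := {x | k ∈ S x}

/-- The product weight of a configuration: `∏_x p_x^{|S x|} (1 - p_x)^{K - |S x|}` — depends on `S` only through the profile
`x ↦ |S x|`. -/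
noncomputable def wprof (p : Fin n → unitInterval) (S : Fin n → Finset (Fin K)) : ℝ :=
  ∏ x, ((p x : ℝ) ^ (S x).card * (1 - (p x : ℝ)) ^ (K - (S x).card))

/-- The transpose of a K-tuple of configurations: vertex `x` ↦ the set of slots whose configuration contains `x`. -/
noncomputable def transpose (c : Fin K → Set (Fin n)) : Fin n → Finset (Fin K) := by
  classical exact fun x => univ.filter fun k => x ∈ c k

/-- Transposition is a bijection between K-tuples of configurations and slot-set assignments. -/
noncomputable def transposeEquiv : (Fin K → Set (Fin n)) ≃ (Fin n → Finset (Fin K)) where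
  toFun := transpose
  invFun := fun S k => row S k
  left_inv := by
    classical
    intro c; funext k; ext x; simp [row, transpose]
  right_inv := by
    classical
    intro S; funext x; ext k; simp [row, transpose]

/-- `row (transpose c) k = c k`. -/
theorem row_transpose (c : Fin K → Set (Fin n)) (k : Fin K) : row (transpose c) k = c k := by
  classical
  ext x; simp [row, transpose]

/-- The product of the K weights is the profile weight of the transpose. -/
theorem prod_weight_eq_wprof (p : Fin n → unitInterval) (c : Fin K → Set (Fin n)) :
    ∏ k, BHK2006.weight (fun e => (p e : ℝ)) (c k) = wprof p (transpose c) := by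
  classical
  unfold BHK2006.weight wprof
  rw [Finset.prod_comm]
  refine Finset.prod_congr rfl fun x _ => ?_
  rw [Finset.prod_ite, Finset.prod_const, Finset.prod_const]
  have h1 : (univ.filter fun k : Fin K => x ∈ c k) = transpose c x := by simp [transpose]
  have h2 : (univ.filter fun k : Fin K => ¬ x ∈ c k).card = K - (transpose c x).card := by
    have := Finset.card_filter_add_card_filter_not (s := (univ : Finset (Fin K))) (fun k => x ∈ c k)
    rw [Finset.card_univ, Fintype.card_fin, h1] at this
    omega
  rw [h1, h2]

open scoped Classical in
/-- G1 (POLARISATION).  `∏_k μ(V k) = Σ_S wprof p S · 𝟙[∀ k, row S k ∈ V k]`. [this work] -/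
theorem prod_real_eq_sum_wprof (p : Fin n → unitInterval) (V : Fin K → Set (Set (Fin n))) :
    ∏ k, (prodBernoulli p).real (V k) =
      ∑ S : Fin n → Finset (Fin K), wprof p S * (if ∀ k, row S k ∈ V k then 1 else 0) := by
  classical
  simp_rw [prodBernoulli_real_eq_sum_weight_ind]
  rw [Finset.prod_univ_sum]
  rw [← transposeEquiv.sum_comp]
  refine Finset.sum_congr rfl fun c _ => ?_
  rw [Finset.prod_mul_distrib, prod_weight_eq_wprof]
  have htr : (transposeEquiv c : Fin n → Finset (Fin K)) = transpose c := rfl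
  rw [htr]
  congr 1
  simp only [row_transpose]
  by_cases h : ∀ k, c k ∈ V k
  · rw [if_pos h]
    exact Finset.prod_eq_one fun k _ => DecisionTree.ind_of_mem (h k)
  · rw [if_neg h]
    push Not at h
    obtain ⟨k, hk⟩ := h
    exact Finset.prod_eq_zero (Finset.mem_univ k) (DecisionTree.ind_of_not_mem hk)

/-- The profile of a slot-set assignment. -/
def prof (S : Fin n → Finset (Fin K)) : Fin n → ℕ := fun x => (S x).card

/-- The weight of a profile. -/
noncomputable def wOfProf (p : Fin n → unitInterval) (m : Fin n → ℕ) : ℝ :=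
  ∏ x, ((p x : ℝ) ^ m x * (1 - (p x : ℝ)) ^ (K - m x))

/-- `wprof_eq` (bridge bookkeeping, g40 memo §1–§3). [this work] -/
theorem wprof_eq (p : Fin n → unitInterval) (S : Fin n → Finset (Fin K)) : wprof p S = wOfProf (K := K) p (prof S) := rfl

/-- `wOfProf_nonneg` (bridge bookkeeping, g40 memo §1–§3). [this work] -/
theorem wOfProf_nonneg (p : Fin n → unitInterval) (m : Fin n → ℕ) : 0 ≤ wOfProf (K := K) p m :=
  Finset.prod_nonneg fun x _ => mul_nonneg (pow_nonneg (p x).2.1 _) (pow_nonneg (sub_nonneg.2 (p x).2.2) _)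

/-- The fibre of a profile is `confs m`. -/
theorem filter_prof_eq_confs (m : Fin n → ℕ) :
    (univ.filter fun S : Fin n → Finset (Fin K) => prof S = m) = TypeModel.Model.confs m := by
  ext S
  simp only [Finset.mem_filter, Finset.mem_univ, true_and, TypeModel.Model.mem_confs, prof, funext_iff]

/-- G1'.  FIBREWISE COUNTING ⟹ WEIGHTED INEQUALITY: if for every profile `m` the configurations of profile `m` satisfying `P` are
at most as many as those satisfying `Q`, then `Σ_S wprof p S 𝟙[P S] ≤ Σ_S wprof p S 𝟙[Q S]` for every `p`. [this work] -/
theorem sum_wprof_le_of_fibrewise (p : Fin n → unitInterval) (P Q : (Fin n → Finset (Fin K)) → Prop)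
    [DecidablePred P] [DecidablePred Q]
    (h : ∀ m : Fin n → ℕ, ((TypeModel.Model.confs (ι := Fin n) m).filter P).card ≤ ((TypeModel.Model.confs m).filter Q).card) :
    ∑ S : Fin n → Finset (Fin K), wprof p S * (if P S then 1 else 0) ≤
      ∑ S : Fin n → Finset (Fin K), wprof p S * (if Q S then 1 else 0) := by
  classical
  have key : ∀ (R : (Fin n → Finset (Fin K)) → Prop) [DecidablePred R],
      ∑ S : Fin n → Finset (Fin K), wprof p S * (if R S then 1 else 0) =
        ∑ m ∈ univ.image (prof (K := K) (n := n)), wOfProf (K := K) p m * ((TypeModel.Model.confs m).filter R).card := by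
    intro R _
    rw [← Finset.sum_fiberwise_of_maps_to (s := univ) (t := univ.image (prof (K := K) (n := n))) (g := prof)
      (fun S hS => Finset.mem_image_of_mem _ hS)]
    refine Finset.sum_congr rfl fun m _ => ?_
    have hfib : ∀ S ∈ univ.filter (fun S : Fin n → Finset (Fin K) => prof S = m),
        wprof p S * (if R S then (1 : ℝ) else 0) = wOfProf (K := K) p m * (if R S then 1 else 0) := by
      intro S hS
      rw [wprof_eq, (Finset.mem_filter.1 hS).2]
    rw [Finset.sum_congr rfl hfib, ← Finset.mul_sum, Finset.sum_boole, filter_prof_eq_confs]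
  rw [key P, key Q]
  exact Finset.sum_le_sum fun m _ => mul_le_mul_of_nonneg_left (by exact_mod_cast h m) (wOfProf_nonneg p m)


end Bridge

end Summit.CriticalPhenomena.PercolationContinuityZ3.Theorems.SunflowerPartition
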